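import Summits.QuantumFields.YangMills.Theorems.BalabanUVNodesN15TwoGridLandauMassless
import HarnessLib

/-!
# Route «BalabanUVNodes», node N15 = NE2, -a lane, part 52: DOOR (iv) — ★★★ ENTRY 0 OF `𝔇(G′, G)` FOR BAŁABAN's FULL LANDAU-GAUGE PROPAGATOR `G = Δ_a⁻¹` AT `U ≡ 1`,
# HYPOTHESIS-FREE: King's (3.71) lines 1–2 at `m² = 0` (part 51) READ FOR b04's KERNEL `K_T = G′Q′*` THROUGH PART 50's DICTIONARY, couplings `a_k ↔ a_{k+m}` by (2.13), into part 49

Cell `pub-ymgap`, seat `pub-ymgap-dag-n15-a` (KNIT-BY-NAME, g12); `--supports stmt-QuantumFields-20290 --as helper`; `HOME/pub-ymgap-dag-n15-a/DOOR-IV-PLAN.md` §7 (route R).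
Over part 50 (`KRe_torIdx_eq_minimiser`, `DKRe_torIdx_eq_minimiser`, `reM_greenOp_eq_fineOp`, `isReal_greenOp`), part 49 (`hasMaj_twoGridDefect_of_kernelPairRates`), King's typed two-spacing
theorems with MASS-UNIFORM constants (`King1986.MinimizerDecayUniform.king_prop38_torus_blocks_unif` = (3.71) line 1, `…MinimizerTwoSpacingDerivUniform.king_prop38_deriv_torus_blocks_unif` =
line 2, for King's `minimiser` with `a_k = aK a L k`, `c = n²`, `0 < m² ≤ m₀²`), n18's uniform outer constants (`N18KingModelTorus.outerRate_le_unif`, `…TorusDeriv.douterRate_le_unif`),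
King's (2.13) algebra (`EffectiveLaplacianRate.inv_aK_add`: `a_{k+m}⁻¹ = a_k⁻¹ + L^{−2k}a_m⁻¹`; `CovarianceRateTorus.aminL_le_aK`), b05's `isUnit_greenOp`, and the (1.126) engine's decays.
WHAT.  (§56) ★★ `KRe_pairRate` ∕ `DKRe_pairRate`:
the same for b04's `K_T` and `∂K_T` at the couplings `a_k`, `a_{k+m}` (part 50 + `K = ℋ∕a`, `a_{k+m}⁻¹ − a_k⁻¹ = L^{−2k}a_m⁻¹` against the tree's decay of `K_T`, `∂K_T`; `m = 0`: the two
kernels coincide).  (§57) ★★★ **`hasMaj_twoGridDefect`**: for odd `L ≥ 3`, `a > 0`, `0 < γ < 1`, there are `δ, C > 0` such that for EVERY torus exponent `m_T`, coarse scale `k ≥ 1` (`η = L^{−k}`)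
and refinement `m`, `𝔇(G′, G) = idef P P G′ G` — King's prolongation defect of Bałaban's FULL Landau-gauge propagator `G = Δ_a⁻¹ = (Δ − ∂Π∂* + aQ*Q)⁻¹` of [B5] (1.69)–(1.71) at `U ≡ 1`
— has the block majorant `C·(L^k)^{−γ∕…}·e^{−δ|y−y′|_T}` on the N15 carrier: ENTRY 0 OF (3.42) FOR `(G′, G)`, HYPOTHESIS-FREE (parts 39–50 + the tree).
HONEST FRAMING ∕ LIMITS.  `U ≡ 1` linear theory on finite tori (the torus family of record `M_μ = 2L^{m_T}`, `n = L^k`); entry 0 only (entries 1–3 of (3.42) and the node readout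
`NE2ZeroOperator` NOT here); the rate exponent is King's `γ∕2` halved again by the geometric means of the lineage — immaterial for NE2's «some γ > 0»; constants crude and ours; Bałaban's
inequalities enter only through the tree's theorems (`prop12_famG_printed`, the (1.126) engine, b04∕b05's kernels) and King's through the tree's `King1986.*`; count-neutral (typed 28∕28 ·
discharged 5∕28 unchanged); NOT a discharge of N15 (object-bound: Node 00's [B9] operator layer of record; NE2⁺ NOT PRINTED); one finite T⁴ at fixed ε — NOT infinite volume, NOT OS on ℝ⁴,
NOT a mass gap, NOT Clay.
-/

noncomputable section

open scoped BigOperators Matrix Topology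
open Finset Filter

namespace Summit.QuantumFields.YangMills.BalabanUVNodes.N15.TwoGrid

open Literature.MathematicalPhysics.QuantumFieldTheory.Balaban1983to89
open Literature.MathematicalPhysics.QuantumFieldTheory.Balaban1983to89.B11SectG (BlockNorm HasMaj)
open Literature.MathematicalPhysics.QuantumFieldTheory.Balaban1983to89.T4EtaRateCoeffDefect (pull fibre mem_fibre)
open Literature.MathematicalPhysics.QuantumFieldTheory.Balaban1983to89.T4EtaRateDefect (idef)
open Literature.MathematicalPhysics.QuantumFieldTheory.Balaban1983to89.B5Prop11Plancherel (Tor fine unitVec)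
open Literature.MathematicalPhysics.QuantumFieldTheory.Balaban1983to89.B5Action121 (LapS)
open Literature.MathematicalPhysics.QuantumFieldTheory.Balaban1983to89.B5Block118 (QsOp)
open Literature.MathematicalPhysics.QuantumFieldTheory.Balaban1983to89.B5Hk160Torus (QsAdj)
open Literature.MathematicalPhysics.QuantumFieldTheory.Balaban1983to89.B5RealFields (IsReal reM reM_one)
open Literature.MathematicalPhysics.QuantumFieldTheory.Balaban1983to89.B5PBridgeGreenInverse (greenOp_mul_inv)
open Literature.MathematicalPhysics.QuantumFieldTheory.Balaban1983to89.B5SiteBridgeP12 (MP)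
open Literature.MathematicalPhysics.QuantumFieldTheory.Balaban1983to89.B4Sect5Torus (tdist tdist_nonneg)
open Literature.MathematicalPhysics.QuantumFieldTheory.Balaban1983to89.B4TorusKernel (periodConst)
open Literature.MathematicalPhysics.QuantumFieldTheory.Balaban1983to89.B4TorusKernel.MultiPeriod (torusSupNorm)
open Literature.MathematicalPhysics.QuantumFieldTheory.Balaban1983to89.B5QGGQ145Bounds (Idx toZ)
open Literature.MathematicalPhysics.QuantumFieldTheory.Balaban1983to89.B5QGGQ145Factor (KRe KRe_decay)
open Literature.MathematicalPhysics.QuantumFieldTheory.Balaban1983to89.B5DPD126Uniform (DKRe cIdx toZ_cIdx tdist_eq_torusSupNorm DKRe_decay)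
open Literature.MathematicalPhysics.QuantumFieldTheory.Balaban1983to89.B5PBridgeProjection (torIdx torIdx_apply)
open Literature.MathematicalPhysics.QuantumFieldTheory.King1986 (aK aK_pos inv_aK_add prop38RateConst prop38PosConst dprop38RateConst dprop38PosConst lemma43Const)
open Literature.MathematicalPhysics.QuantumFieldTheory.King1986.Torus (blockOf tdistT tdistT_nonneg lapF fineOp minimiser Qmat aminL aminL_pos aminL_le_aK
  king_prop38_torus_blocks_unif king_prop38_deriv_torus_blocks_unif)
open Literature.MathematicalPhysics.QuantumFieldTheory.Balaban1983to89.B6UnitTorusCarrier (unitTorusGeo)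
open Summit.QuantumFields.YangMills.BalabanUVNodes.N15.VectorPiece (blkFine kingPr kingPrV kingPr_val)
open Summit.QuantumFields.YangMills.BalabanUVNodes.N18KingModelTorus (outerRate_le_unif)
open Summit.QuantumFields.YangMills.BalabanUVNodes.N18KingModelTorusDeriv (douterRate_le_unif)

variable {d : ℕ}

/-! ## §56 ★★ The paired two-grid rates of b04's `K_T` and `∂K_T` at the couplings `a_k`, `a_{k+m}` -/

section PairRates

variable {L : ℕ} [NeZero L]

/-- `K_T` does not depend on the spelling of its fineness. [folklore] -/
theorem KT_congr_n {n₁ n₂ : ℕ} [NeZero n₁] [NeZero n₂] (h : n₁ = n₂) (a m2 : ℝ) (N : Fin (d + 1) → ℕ) (z y : Fin (d + 1) → ℤ) :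
    B4TorusGreen244.KT n₁ a m2 N z y = B4TorusGreen244.KT n₂ a m2 N z y := by
  subst h; rfl

/-- at refinement `m = 0` King's pairing is the identity on coordinates: the chart images agree. [folklore] -/
theorem toZ_torIdx_kingPr_zero (k : ℕ) (M : Fin (d + 1) → ℕ) [∀ μ, NeZero (M μ)] (w' : Tor (fine (L ^ 0 * L ^ k) M)) :
    toZ (torIdx (fine (L ^ k) M) (kingPr L k 0 M w')) = toZ (torIdx (fine (L ^ 0 * L ^ k) M) w') := by
  funext i
  simp only [B5QGGQ145Bounds.toZ, torIdx_apply, B5RowSumsP12Lattice.chartSite_apply_val, kingPr_val, pow_zero, Nat.div_one]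

/-- at `m = 0` the two `K_T` kernels coincide. [folklore] -/
theorem KRe_kingPr_zero (k : ℕ) (M : Fin (d + 1) → ℕ) [∀ μ, NeZero (M μ)] (a : ℝ) (w' : Tor (fine (L ^ 0 * L ^ k) M)) (k' : Idx M) :
    KRe (L ^ 0 * L ^ k) a M (torIdx (fine (L ^ 0 * L ^ k) M) w') k' = KRe (L ^ k) a M (torIdx (fine (L ^ k) M) (kingPr L k 0 M w')) k' := by
  haveI : NeZero (L ^ 0 * L ^ k) := ⟨Nat.mul_ne_zero (pow_ne_zero _ (NeZero.ne L)) (pow_ne_zero _ (NeZero.ne L))⟩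
  simp only [KRe, Matrix.of_apply]
  rw [toZ_torIdx_kingPr_zero, KT_congr_n (show L ^ 0 * L ^ k = L ^ k by rw [pow_zero, one_mul])]

/-- at `m = 0` the two gradient kernels coincide. [folklore] -/
theorem DKRe_kingPr_zero (k : ℕ) (M : Fin (d + 1) → ℕ) [∀ μ, NeZero (M μ)] (a : ℝ) (s : Fin (d + 1)) (w' : Tor (fine (L ^ 0 * L ^ k) M)) (k' : Idx M) :
    DKRe (L ^ 0 * L ^ k) a M s (torIdx (fine (L ^ 0 * L ^ k) M) w') k' = DKRe (L ^ k) a M s (torIdx (fine (L ^ k) M) (kingPr L k 0 M w')) k' := by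
  haveI : NeZero (L ^ 0 * L ^ k) := ⟨Nat.mul_ne_zero (pow_ne_zero _ (NeZero.ne L)) (pow_ne_zero _ (NeZero.ne L))⟩
  simp only [DKRe, Matrix.of_apply]
  rw [toZ_torIdx_kingPr_zero, KT_congr_n (show L ^ 0 * L ^ k = L ^ k by rw [pow_zero, one_mul]), KT_congr_n (show L ^ 0 * L ^ k = L ^ k by rw [pow_zero, one_mul])]
  push_cast
  rw [pow_zero, one_mul]

end PairRates


/-! ## §57 ★★★ Entry 0 of `𝔇(G′, G)` for Bałaban's full Landau-gauge propagator at `U ≡ 1`, hypothesis-free -/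

section Final

variable {L : ℕ} [NeZero L]

/-- the coupling bookkeeping `K′ − K = a′⁻¹(ℋ′ − ℋ) + ε·(a∕a_m)·K` in absolute values. [cite: King1986, (2.13) p.653, (4.12) p.671] -/
theorem abs_couplingPair_le {a a' am ε H H' K : ℝ} (ha : 0 < a) (ha' : 0 < a') (ham : 0 < am) (hε : 0 ≤ ε) (hinv : a'⁻¹ = a⁻¹ + ε * am⁻¹) (hK : K = a⁻¹ * H) :
    |a'⁻¹ * H' - K| ≤ a'⁻¹ * |H' - H| + ε * (a / am) * |K| := by
  have hid : a'⁻¹ * H' - K = a'⁻¹ * (H' - H) + ε * (a / am) * K := by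
    rw [hK, mul_sub, show a'⁻¹ * H = (a⁻¹ + ε * am⁻¹) * H by rw [hinv]]
    field_simp
    ring
  rw [hid]
  refine (abs_add_le _ _).trans ?_
  rw [abs_mul, abs_of_pos (inv_pos.mpr ha'), abs_mul, abs_of_nonneg (by positivity : 0 ≤ ε * (a / am))]

omit [NeZero L] in
/-- `L^{−2k} ≤ (L^k)^{−c}` for `c ≤ 2`, `L ≥ 1`. [folklore] -/
theorem inv_pow_two_mul_le_rpow (hL1 : 1 ≤ L) (k : ℕ) {c : ℝ} (hc : c ≤ 2) : ((L : ℝ) ^ (2 * k))⁻¹ ≤ ((L ^ k : ℕ) : ℝ) ^ (-c) := by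
  have hLk : (1 : ℝ) ≤ ((L ^ k : ℕ) : ℝ) := by exact_mod_cast Nat.one_le_pow _ _ hL1
  have h0 : (0 : ℝ) < ((L ^ k : ℕ) : ℝ) := by linarith
  have e : ((L : ℝ) ^ (2 * k))⁻¹ = ((L ^ k : ℕ) : ℝ) ^ (-(2 : ℝ)) := by
    rw [Real.rpow_neg h0.le, show (2 : ℝ) = ((2 : ℕ) : ℝ) by norm_num, Real.rpow_natCast]
    push_cast
    rw [← pow_mul, mul_comm]
  rw [e]
  exact Real.rpow_le_rpow_of_exponent_le hLk (by linarith)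

/-- ★★ **THE PAIRED TWO-GRID RATE OF b04's `K_T` AT KING's COUPLINGS** (King's (3.71) line 1 at `m² = 0` read through part 50's dictionary; the coupling discrepancy `a_{k+m}⁻¹ − a_k⁻¹ =
L^{−2k}a_m⁻¹` against the tree's decay of `K_T`; `m = 0`: the kernels coincide): generic torus `M_μ = 2L^{m_T}`. [cite: King1986, Prop. 3.8 (3.71) p.664 (first line), (2.13) p.653;
Balaban1983RegularityDecay, Lemma 2.4 (2.35) p.582] -/
theorem KRe_pairRate_member (hLodd : Odd L) (hL2 : 2 ≤ L) {a : ℝ} (ha : 0 < a) {γ : ℝ} (hγ0 : 0 < γ) (hγ1 : γ < 1) :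
    ∃ ρ δ : ℝ, 0 < ρ ∧ 0 < δ ∧ ∀ (mT k m : ℕ) (hk : 1 ≤ k) (hL : Odd L ∧ 1 < L) (M : Fin (d + 1) → ℕ) [∀ μ, NeZero (M μ)]
      (_hM : ∀ μ, M μ = 2 * L ^ mT) (w' : Tor (fine (L ^ m * L ^ k) M)) (k' : Idx M),
      |KRe (L ^ m * L ^ k) (aK a L (k + m)) M (torIdx (fine (L ^ m * L ^ k) M) w') k' - KRe (L ^ k) (aK a L k) M (torIdx (fine (L ^ k) M) (kingPr L k m M w')) k'|
        ≤ ρ * ((L ^ k : ℕ) : ℝ) ^ (-(γ / 2)) * Real.exp (-(δ * tdist M (cIdx (L ^ k) M (torIdx (fine (L ^ k) M) (kingPr L k m M w'))) k')) := by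
  have hL1 : 1 ≤ L := by omega
  have hLr : (1 : ℝ) < L := by exact_mod_cast (show 1 < L by omega)
  have hamin := aminL_pos ha hL2
  obtain ⟨C₁, δ₁, hC₁, hδ₁, H1⟩ := king_line1_massless (d := d) hLodd hL2 ha hγ0.le hγ1.le
  obtain ⟨κ₁, M₁, hκ₁, hM₁, HK⟩ := KRe_decay d (aminL a L) a hamin
  have hd1 : (0 : ℝ) < (d : ℝ) + 1 := by positivity
  have hpc1 : 0 ≤ periodConst κ₁ d := (B5Kernel166Decay.periodConst_pos hκ₁ d).le
  obtain ⟨δR, hδR⟩ : ∃ δR : ℝ, δR = min δ₁ (κ₁ / (d + 1)) := ⟨_, rfl⟩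
  have hδRpos : 0 < δR := hδR ▸ lt_min hδ₁ (div_pos hκ₁ hd1)
  have hR1 : δR ≤ δ₁ := hδR ▸ min_le_left _ _
  have hR3 : δR ≤ κ₁ / (d + 1) := hδR ▸ min_le_right _ _
  obtain ⟨ρ, hρ⟩ : ∃ ρ : ℝ, ρ = (aminL a L)⁻¹ * C₁ + a / aminL a L * (M₁ * periodConst κ₁ d) + 1 := ⟨_, rfl⟩
  have hρpos : 0 < ρ := by rw [hρ]; positivity
  refine ⟨ρ, δR, hρpos, hδRpos, fun mT k m hk hL M _ hM w' k' => ?_⟩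
  have hM1 : ∀ i, 1 ≤ M i := fun i => Nat.one_le_iff_ne_zero.mpr (NeZero.ne (M i))
  haveI : NeZero (L ^ m * L ^ k) := ⟨Nat.mul_ne_zero (pow_ne_zero _ (NeZero.ne L)) (pow_ne_zero _ (NeZero.ne L))⟩
  have hak := aminL_le_aK ha hL2 hk
  have haK : 0 < aK a L k := aK_pos ha hLr hk
  have haK' : 0 < aK a L (k + m) := aK_pos ha hLr (by omega)
  have hakm := aminL_le_aK ha hL2 (show 1 ≤ k + m by omega)
  have hn1 : (1 : ℝ) ≤ ((L ^ k : ℕ) : ℝ) := by exact_mod_cast Nat.one_le_pow _ _ hL1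
  have hrγ : 0 ≤ ((L ^ k : ℕ) : ℝ) ^ (-(γ / 2)) := Real.rpow_nonneg (by linarith) _
  have hε : ((L : ℝ) ^ (2 * k))⁻¹ ≤ ((L ^ k : ℕ) : ℝ) ^ (-(γ / 2)) := inv_pow_two_mul_le_rpow hL1 k (by linarith)
  have hε0 : 0 ≤ ((L : ℝ) ^ (2 * k))⁻¹ := by positivity
  have hainv : (aK a L (k + m))⁻¹ ≤ (aminL a L)⁻¹ := inv_anti₀ hamin hakm.1
  obtain ⟨b, rfl⟩ : ∃ b : Tor M, torIdx M b = k' := ⟨(torIdx M).symm k', Equiv.apply_symm_apply _ _⟩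
  have hdist : tdist M (cIdx (L ^ k) M (torIdx (fine (L ^ k) M) (kingPr L k m M w'))) (torIdx M b) = tdistT M (blockOf (L ^ k) M (kingPr L k m M w')) b := by
    rw [cIdx_torIdx]; rfl
  rw [hdist]
  set T := tdistT M (blockOf (L ^ k) M (kingPr L k m M w')) b with hT
  have hT0 : 0 ≤ T := tdistT_nonneg _ _ _
  have hexp : ∀ {δ' : ℝ}, δR ≤ δ' → Real.exp (-(δ' * T)) ≤ Real.exp (-(δR * T)) := fun hle => Real.exp_le_exp.mpr (by nlinarith)
  have hRHS : 0 ≤ ρ * ((L ^ k : ℕ) : ℝ) ^ (-(γ / 2)) * Real.exp (-(δR * T)) := by positivity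
  rcases Nat.eq_zero_or_pos m with hm0 | hm
  · subst hm0
    rw [KRe_kingPr_zero, Nat.add_zero, sub_self, abs_zero]
    exact hRHS
  have haKm : 0 < aK a L m := aK_pos ha hLr hm
  have hratio : aK a L k / aK a L m ≤ a / aminL a L := div_le_div₀ ha.le hak.2 hamin (aminL_le_aK ha hL2 hm).1
  have hK' := KRe_torIdx_eq_minimiser M (L ^ m * L ^ k) haK' w' b
  have hK := KRe_torIdx_eq_minimiser M (L ^ k) haK (kingPr L k m M w') b
  have h1 := H1 mT k m hk hm hL M hM w' b
  have hdec : |KRe (L ^ k) (aK a L k) M (torIdx (fine (L ^ k) M) (kingPr L k m M w')) (torIdx M b)| ≤ M₁ * periodConst κ₁ d * Real.exp (-(κ₁ / (d + 1) * T)) := by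
    have h := HK (L ^ k) (aK a L k) hak.1 hak.2 M hM1 (torIdx (fine (L ^ k) M) (kingPr L k m M w')) (torIdx M b)
    rw [← toZ_cIdx, ← tdist_eq_torusSupNorm hM1, hdist] at h
    exact h
  rw [hK']
  have hp := abs_couplingPair_le (H' := minimiser (L ^ m * L ^ k) M (aK a L (k + m)) (((L ^ m * L ^ k : ℕ) : ℝ) ^ 2) 0 (Pi.single b 1) w')
    haK haK' haKm hε0 (inv_aK_add ha hLr k m) hK
  refine hp.trans ?_
  have hA := mul_le_mul hainv (h1.trans (mul_le_mul_of_nonneg_left (hexp hR1) (by positivity))) (abs_nonneg _) (inv_nonneg.mpr hamin.le)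
  have hB := mul_le_mul (mul_le_mul hε hratio (div_nonneg haK.le haKm.le) hrγ) (hdec.trans (mul_le_mul_of_nonneg_left (hexp hR3) (by positivity)))
    (abs_nonneg _) (mul_nonneg hrγ (div_nonneg ha.le hamin.le))
  refine (add_le_add hA hB).trans ?_
  have hE := Real.exp_nonneg (-(δR * T))
  have hrest : (aminL a L)⁻¹ * C₁ + a / aminL a L * (M₁ * periodConst κ₁ d) ≤ ρ := by rw [hρ]; linarith
  calc (aminL a L)⁻¹ * (C₁ * ((L ^ k : ℕ) : ℝ) ^ (-(γ / 2)) * Real.exp (-(δR * T)))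
        + ((L ^ k : ℕ) : ℝ) ^ (-(γ / 2)) * (a / aminL a L) * (M₁ * periodConst κ₁ d * Real.exp (-(δR * T)))
      = ((aminL a L)⁻¹ * C₁ + a / aminL a L * (M₁ * periodConst κ₁ d)) * (((L ^ k : ℕ) : ℝ) ^ (-(γ / 2)) * Real.exp (-(δR * T))) := by ring
    _ ≤ ρ * (((L ^ k : ℕ) : ℝ) ^ (-(γ / 2)) * Real.exp (-(δR * T))) := mul_le_mul_of_nonneg_right hrest (mul_nonneg hrγ hE)
    _ = ρ * ((L ^ k : ℕ) : ℝ) ^ (-(γ / 2)) * Real.exp (-(δR * T)) := by ring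

/-- ★★ **THE PAIRED TWO-GRID RATE OF b04's `∂K_T` AT KING's COUPLINGS** (King's (3.71) line 2 at `m² = 0` + part 50 + (2.13) + the tree's decay of `∂K_T`). [cite: King1986, Prop. 3.8 (3.71)
p.664 (second line), (2.13) p.653; Balaban1983RegularityDecay, Lemma 2.4 (2.35) p.582 (second quantity)] -/
theorem DKRe_pairRate_member (hLodd : Odd L) (hL2 : 2 ≤ L) {a : ℝ} (ha : 0 < a) {γ : ℝ} (hγ0 : 0 < γ) (hγ1 : γ < 1) :
    ∃ ρ δ : ℝ, 0 < ρ ∧ 0 < δ ∧ ∀ (mT k m : ℕ) (hk : 1 ≤ k) (hL : Odd L ∧ 1 < L) (M : Fin (d + 1) → ℕ) [∀ μ, NeZero (M μ)]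
      (_hM : ∀ μ, M μ = 2 * L ^ mT) (s : Fin (d + 1)) (w' : Tor (fine (L ^ m * L ^ k) M)) (k' : Idx M),
      |DKRe (L ^ m * L ^ k) (aK a L (k + m)) M s (torIdx (fine (L ^ m * L ^ k) M) w') k' - DKRe (L ^ k) (aK a L k) M s (torIdx (fine (L ^ k) M) (kingPr L k m M w')) k'|
        ≤ ρ * ((L ^ k : ℕ) : ℝ) ^ (-(γ / 2)) * Real.exp (-(δ * tdist M (cIdx (L ^ k) M (torIdx (fine (L ^ k) M) (kingPr L k m M w'))) k')) := by
  have hL1 : 1 ≤ L := by omega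
  have hLr : (1 : ℝ) < L := by exact_mod_cast (show 1 < L by omega)
  have hamin := aminL_pos ha hL2
  obtain ⟨C₂, δ₂, hC₂, hδ₂, H2⟩ := king_line2_massless (d := d) hLodd hL2 ha hγ0.le hγ1
  obtain ⟨κ₂, M₂, hκ₂, hM₂, HD⟩ := DKRe_decay d (aminL a L) a hamin
  have hd1 : (0 : ℝ) < (d : ℝ) + 1 := by positivity
  have hpc2 : 0 ≤ periodConst κ₂ d := (B5Kernel166Decay.periodConst_pos hκ₂ d).le
  obtain ⟨δR, hδR⟩ : ∃ δR : ℝ, δR = min δ₂ (κ₂ / (d + 1)) := ⟨_, rfl⟩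
  have hδRpos : 0 < δR := hδR ▸ lt_min hδ₂ (div_pos hκ₂ hd1)
  have hR2 : δR ≤ δ₂ := hδR ▸ min_le_left _ _
  have hR4 : δR ≤ κ₂ / (d + 1) := hδR ▸ min_le_right _ _
  obtain ⟨ρ, hρ⟩ : ∃ ρ : ℝ, ρ = (aminL a L)⁻¹ * C₂ + a / aminL a L * (M₂ * periodConst κ₂ d) + 1 := ⟨_, rfl⟩
  have hρpos : 0 < ρ := by rw [hρ]; positivity
  refine ⟨ρ, δR, hρpos, hδRpos, fun mT k m hk hL M _ hM s w' k' => ?_⟩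
  have hM1 : ∀ i, 1 ≤ M i := fun i => Nat.one_le_iff_ne_zero.mpr (NeZero.ne (M i))
  haveI : NeZero (L ^ m * L ^ k) := ⟨Nat.mul_ne_zero (pow_ne_zero _ (NeZero.ne L)) (pow_ne_zero _ (NeZero.ne L))⟩
  have hak := aminL_le_aK ha hL2 hk
  have haK : 0 < aK a L k := aK_pos ha hLr hk
  have haK' : 0 < aK a L (k + m) := aK_pos ha hLr (by omega)
  have hakm := aminL_le_aK ha hL2 (show 1 ≤ k + m by omega)
  have hn1 : (1 : ℝ) ≤ ((L ^ k : ℕ) : ℝ) := by exact_mod_cast Nat.one_le_pow _ _ hL1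
  have hrγ : 0 ≤ ((L ^ k : ℕ) : ℝ) ^ (-(γ / 2)) := Real.rpow_nonneg (by linarith) _
  have hε : ((L : ℝ) ^ (2 * k))⁻¹ ≤ ((L ^ k : ℕ) : ℝ) ^ (-(γ / 2)) := inv_pow_two_mul_le_rpow hL1 k (by linarith)
  have hε0 : 0 ≤ ((L : ℝ) ^ (2 * k))⁻¹ := by positivity
  have hainv : (aK a L (k + m))⁻¹ ≤ (aminL a L)⁻¹ := inv_anti₀ hamin hakm.1
  obtain ⟨b, rfl⟩ : ∃ b : Tor M, torIdx M b = k' := ⟨(torIdx M).symm k', Equiv.apply_symm_apply _ _⟩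
  have hdist : tdist M (cIdx (L ^ k) M (torIdx (fine (L ^ k) M) (kingPr L k m M w'))) (torIdx M b) = tdistT M (blockOf (L ^ k) M (kingPr L k m M w')) b := by
    rw [cIdx_torIdx]; rfl
  rw [hdist]
  set T := tdistT M (blockOf (L ^ k) M (kingPr L k m M w')) b with hT
  have hT0 : 0 ≤ T := tdistT_nonneg _ _ _
  have hexp : ∀ {δ' : ℝ}, δR ≤ δ' → Real.exp (-(δ' * T)) ≤ Real.exp (-(δR * T)) := fun hle => Real.exp_le_exp.mpr (by nlinarith)
  have hRHS : 0 ≤ ρ * ((L ^ k : ℕ) : ℝ) ^ (-(γ / 2)) * Real.exp (-(δR * T)) := by positivity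
  rcases Nat.eq_zero_or_pos m with hm0 | hm
  · subst hm0
    rw [DKRe_kingPr_zero, Nat.add_zero, sub_self, abs_zero]
    exact hRHS
  have haKm : 0 < aK a L m := aK_pos ha hLr hm
  have hratio : aK a L k / aK a L m ≤ a / aminL a L := div_le_div₀ ha.le hak.2 hamin (aminL_le_aK ha hL2 hm).1
  have hK' := DKRe_torIdx_eq_minimiser M (L ^ m * L ^ k) haK' s w' b
  have hK := DKRe_torIdx_eq_minimiser M (L ^ k) haK s (kingPr L k m M w') b
  have h2 := H2 mT k m hk hm hL M hM w' b s
  have hdec : |DKRe (L ^ k) (aK a L k) M s (torIdx (fine (L ^ k) M) (kingPr L k m M w')) (torIdx M b)| ≤ M₂ * periodConst κ₂ d * Real.exp (-(κ₂ / (d + 1) * T)) := by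
    have h := HD (L ^ k) (aK a L k) hak.1 hak.2 M hM1 s (torIdx (fine (L ^ k) M) (kingPr L k m M w')) (torIdx M b)
    rw [← toZ_cIdx, ← tdist_eq_torusSupNorm hM1, hdist] at h
    exact h
  rw [hK']
  have hp := abs_couplingPair_le (H' := ((L ^ m * L ^ k : ℕ) : ℝ) *
      (minimiser (L ^ m * L ^ k) M (aK a L (k + m)) (((L ^ m * L ^ k : ℕ) : ℝ) ^ 2) 0 (Pi.single b 1) (w' + unitVec (fine (L ^ m * L ^ k) M) s)
        - minimiser (L ^ m * L ^ k) M (aK a L (k + m)) (((L ^ m * L ^ k : ℕ) : ℝ) ^ 2) 0 (Pi.single b 1) w'))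
    haK haK' haKm hε0 (inv_aK_add ha hLr k m) hK
  refine hp.trans ?_
  have hA := mul_le_mul hainv (h2.trans (mul_le_mul_of_nonneg_left (hexp hR2) (by positivity))) (abs_nonneg _) (inv_nonneg.mpr hamin.le)
  have hB := mul_le_mul (mul_le_mul hε hratio (div_nonneg haK.le haKm.le) hrγ) (hdec.trans (mul_le_mul_of_nonneg_left (hexp hR4) (by positivity)))
    (abs_nonneg _) (mul_nonneg hrγ (div_nonneg ha.le hamin.le))
  refine (add_le_add hA hB).trans ?_
  have hE := Real.exp_nonneg (-(δR * T))
  have hrest : (aminL a L)⁻¹ * C₂ + a / aminL a L * (M₂ * periodConst κ₂ d) ≤ ρ := by rw [hρ]; linarith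
  calc (aminL a L)⁻¹ * (C₂ * ((L ^ k : ℕ) : ℝ) ^ (-(γ / 2)) * Real.exp (-(δR * T)))
        + ((L ^ k : ℕ) : ℝ) ^ (-(γ / 2)) * (a / aminL a L) * (M₂ * periodConst κ₂ d * Real.exp (-(δR * T)))
      = ((aminL a L)⁻¹ * C₂ + a / aminL a L * (M₂ * periodConst κ₂ d)) * (((L ^ k : ℕ) : ℝ) ^ (-(γ / 2)) * Real.exp (-(δR * T))) := by ring
    _ ≤ ρ * (((L ^ k : ℕ) : ℝ) ^ (-(γ / 2)) * Real.exp (-(δR * T))) := mul_le_mul_of_nonneg_right hrest (mul_nonneg hrγ hE)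
    _ = ρ * ((L ^ k : ℕ) : ℝ) ^ (-(γ / 2)) * Real.exp (-(δR * T)) := by ring

/-- ★★★ **ENTRY 0 OF THE TWO-GRID DEFECT OF BAŁABAN's FULL LANDAU-GAUGE PROPAGATOR `G = Δ_a⁻¹` AT `U ≡ 1`, HYPOTHESIS-FREE.**  For odd `L ≥ 3`, `a > 0` and `0 < γ < 1` there are
`δ, C > 0` such that for EVERY torus exponent `m_T` (unit torus `M_μ = 2L^{m_T}`), EVERY coarse scale `k ≥ 1` (`η = L^{−k}`) and EVERY refinement `m` (`η′ = η∕L^m`):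
`𝔇(G′, G) := idef P P G′ G = G′∘P − P∘G` (`G = gOp M (L^k) a` = `(Δ − ∂Π∂* + aQ*Q)⁻¹` on real 1-forms of `T_η` ([B5] (1.69)–(1.71)), `G′` the same on `T_{η′}`, `P` King's prolongation) has the
block majorant `C·(L^k)^{−γ∕2}·e^{−δ|y−y′|_T}` from coarse 1-forms blocked by King's unit blocks to fine 1-forms blocked likewise — the FIRST ENTRY of [B9] (3.42) for the pair `(G′, G)`, in
the N15 lineage's `HasMaj` currency (rate `η^{γ∕2}`, clean).  CHAIN: part 46 (resolvent split; Laplacian terms part 43, output swap 44, averaging 45) + 47 (Landau term ⇐ kernel rate of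
`∂Π∂*`) + 48 (⇐ factor rates of `∂G′Q′*`, `(Q′G′²Q′*)⁻¹` via b05's (1.126) engine) + 49 (⇐ paired rates of `K_T = G′Q′*` and `∂K_T`) + 50 (`K_T = a⁻¹·ℋ`, King's minimiser) + THIS FILE
(King's Prop. 3.8 (3.71) lines 1–2 from the tree's mass-uniform theorems at `m² → 0⁺`, couplings `a_k ↔ a_{k+m}` by (2.13)); Bałaban's (1.110)∕(1.111)∕(1.126) and King's (3.71) enter ONLY
through the tree's theorems (`prop12_famG_printed`, `B5DPD126Uniform`, `King1986.*`). [cite: Balaban1984PropagatorsI, (1.69)–(1.71) pp.29–30, Prop. 1.2 (1.110)–(1.111) p.35, (1.126) p.38;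
Balaban1985BackgroundPropagators, (3.42) p.397 (first entry, shape); King1986, Prop. 3.8 (3.71) p.664, Prop. 3.9 (3.73) p.664 (η-rate shape), (2.13) p.653] -/
theorem hasMaj_twoGridDefect (hLodd : Odd L) (hL2 : 2 ≤ L) {a : ℝ} (ha : 0 < a) {γ : ℝ} (hγ0 : 0 < γ) (hγ1 : γ < 1) :
    ∃ δ C : ℝ, 0 < δ ∧ 0 < C ∧ ∀ (mT k m : ℕ) (hk : 1 ≤ k) (hL : Odd L ∧ 1 < L),
      HasMaj (BlockNorm.ofBlocks (unitTorusGeo L k (MP (paramsOf d L mT k hL))) (blkFine L k (MP (paramsOf d L mT k hL))))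
        (BlockNorm.ofBlocks (unitTorusGeo L k (MP (paramsOf d L mT k hL)))
          (fun i : Tor (fine (L ^ m * L ^ k) (MP (paramsOf d L mT k hL))) × Fin (d + 1) => blockOf (L ^ m * L ^ k) (MP (paramsOf d L mT k hL)) i.1))
        (idef (pull (kingPrV L k m (MP (paramsOf d L mT k hL)))) (pull (kingPrV L k m (MP (paramsOf d L mT k hL))))
          (gOp (MP (paramsOf d L mT k hL)) (L ^ m * L ^ k) a) (gOp (MP (paramsOf d L mT k hL)) (L ^ k) a))
        (fun y y' => C * ((L ^ k : ℕ) : ℝ) ^ (-(γ / 2)) * Real.exp (-(δ * tdistT (MP (paramsOf d L mT k hL)) y y'))) := by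
  have hL : Odd L ∧ 1 < L := ⟨hLodd, by omega⟩
  have hamin := aminL_pos ha hL2
  obtain ⟨ρ₁, δ₁, hρ₁, hδ₁, P1⟩ := KRe_pairRate_member (d := d) hLodd hL2 ha hγ0 hγ1
  obtain ⟨ρ₂, δ₂, hρ₂, hδ₂, P2⟩ := DKRe_pairRate_member (d := d) hLodd hL2 ha hγ0 hγ1
  have hmono : ∀ {ρ' δ' t : ℝ}, 0 ≤ t → 0 ≤ ρ' → ρ' ≤ ρ₁ + ρ₂ → min δ₁ δ₂ ≤ δ' → ∀ k : ℕ,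
      ρ' * ((L ^ k : ℕ) : ℝ) ^ (-(γ / 2)) * Real.exp (-(δ' * t)) ≤ (ρ₁ + ρ₂) * ((L ^ k : ℕ) : ℝ) ^ (-(γ / 2)) * Real.exp (-(min δ₁ δ₂ * t)) := by
    intro ρ' δ' t ht hρ' hle hδ k
    have hr : 0 ≤ ((L ^ k : ℕ) : ℝ) ^ (-(γ / 2)) := Real.rpow_nonneg (Nat.cast_nonneg _) _
    exact mul_le_mul (mul_le_mul_of_nonneg_right hle hr) (Real.exp_le_exp.mpr (by nlinarith)) (Real.exp_nonneg _) (by positivity)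
  have key := hasMaj_twoGridDefect_of_kernelPairRates (d := d) (aplus := a) hL ha hamin (γ := γ / 2) (by positivity) (by linarith)
    (lt_min hδ₁ hδ₂) (show 0 < ρ₁ + ρ₂ by positivity)
  refine (key ?_).elim fun δ h => h.elim fun C h => ⟨δ, C, h.1, h.2.1, fun mT k m hk _ => h.2.2 mT k m hk⟩
  intro mT k m hk
  have hak := aminL_le_aK ha hL2 hk
  have hakm := aminL_le_aK ha hL2 (show 1 ≤ k + m by omega)
  refine ⟨aK a L k, aK a L (k + m), hak.1, hak.2, hakm.1, hakm.2, fun w' k' => ?_, fun s w' k' => ?_⟩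
  · exact (P1 mT k m hk hL (MP (paramsOf d L mT k hL)) (fun μ => rfl) w' k').trans
      (hmono (tdist_nonneg _ _ _) hρ₁.le (by linarith) (min_le_left _ _) k)
  · exact (P2 mT k m hk hL (MP (paramsOf d L mT k hL)) (fun μ => rfl) s w' k').trans
      (hmono (tdist_nonneg _ _ _) hρ₂.le (by linarith) (min_le_right _ _) k)

end Final

end Summit.QuantumFields.YangMills.BalabanUVNodes.N15.TwoGrid
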